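import Mathlib.LinearAlgebra.FreeModule.Finite.Quotient
import Mathlib.LinearAlgebra.Determinant
import Mathlib.NumberTheory.Padics.PadicIntegers
import Mathlib.NumberTheory.Padics.RingHoms
import Mathlib.RingTheory.Norm.Defs
import Mathlib.Analysis.Normed.Ring.Lemmas
import HarnessLib

/-!
# The index of a full sublattice of a free `ℤ_p`-module is `‖det‖⁻¹` (proofs file)

Topic `NumberTheory/EllipticCurves` (next to `IwasawaAlgebraSpecializationCoprimeProofs`, whose specialised indices
`#(Λ ⧸ (Q, g))` it converts into `p`-adic absolute values). THEOREMS ONLY (no definition, no named fact, no `sorry`):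
the `ℤ_p`-analogue of Mathlib's `Submodule.natAbs_det_equiv` / `AddSubgroup.index_eq_natAbs_det` (stated there over
`ℤ` with `Int.natAbs`): for a finite free `ℤ_p`-module `M` and a submodule `N` with `e : M ≃ N`,
`#(M ⧸ N) · ‖det(N ↪ M ∘ e)‖ = 1`; in particular `#(M ⧸ φ(M)) = ‖det φ‖⁻¹ = p^{v_p(det φ)}` for an injective
endomorphism `φ`, and `#(S ⧸ sS) = ‖N_{S/ℤ_p}(s)‖⁻¹` for a non-zero-divisor `s` of a finite free `ℤ_p`-algebra `S`.
Proof: Smith normal form (`Submodule.smithNormalFormCoeffs/TopBasis/BotBasis`, `Submodule.quotientEquivPiSpan`, in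
Mathlib for PIDs) and `#(ℤ_p ⧸ a ℤ_p) = ‖a‖⁻¹`. Written by the lead seat of line `birth` on crux K1
stmt-BirchSwinnertonDyer-24198 (research child A = stmt-26896) as step 1 of the VALUES LINK
`#(Λ ⧸ (f_x, g)) = ‖g(x)‖^{-deg f_x}` between the index-currency specialisation principle and the values-currency
adapters of that crux. HONEST FRAMING: linear algebra over `ℤ_p`; nothing arithmetic; BSD is not proved by any of this.

* `PadicInt.card_quotient_span_singleton` — `#(ℤ_p ⧸ (a)) = ‖a‖⁻¹` for `a ≠ 0` (as a real number).
* `PadicInt.card_quotient_mul_norm_det_eq_one` — `#(M ⧸ N) · ‖det (N.subtype ∘ e)‖ = 1` for `e : M ≃ₗ N`.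
* `PadicInt.card_quotient_range_eq_inv_norm_det` — `#(M ⧸ φ(M)) = ‖det φ‖⁻¹` for `φ` injective.
* `PadicInt.card_quotient_span_singleton_eq_inv_norm_norm` — `#(S ⧸ (s)) = ‖N_{S/ℤ_p}(s)‖⁻¹` for `s` a
  non-zero-divisor of a finite free commutative `ℤ_p`-algebra `S`.

References: [Washington1997] §13.3 (indices of lattices via determinants, proof of Thm. 13.13); [AtiyahMacdonald1969]
Ch. 2 (Prop. 2.14, 2.18) and the structure of finitely generated modules over a PID (Smith normal form).
-/

set_option autoImplicit false

noncomputable section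

open scoped Classical
open Module

namespace Literature.NumberTheory.EllipticCurves

namespace PadicInt

variable {p : ℕ} [Fact p.Prime]

/-- `#(ℤ_p ⧸ (a)) = ‖a‖⁻¹` for `a ≠ 0`: `(a) = (p^k)` with `k = v_p(a)`, `ℤ_p ⧸ (p^k) ≅ ℤ/p^k`, `‖a‖ = p^{-k}`.
[cite: Washington1997, §13.2 (Lemma 13.7)] -/
theorem card_quotient_span_singleton {a : ℤ_[p]} (ha : a ≠ 0) :
    (Nat.card (ℤ_[p] ⧸ Ideal.span {a}) : ℝ) = ‖a‖⁻¹ := by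
  have hspan : Ideal.span {a} = Ideal.span {(p : ℤ_[p]) ^ a.valuation} := by
    conv_lhs => rw [_root_.PadicInt.unitCoeff_spec ha]
    exact Ideal.span_singleton_mul_left_unit (_root_.PadicInt.unitCoeff ha).isUnit _
  have hcard : Nat.card (ℤ_[p] ⧸ Ideal.span {a}) = p ^ a.valuation := by
    rw [hspan, ← _root_.PadicInt.ker_toZModPow,
      Nat.card_congr (RingHom.quotientKerEquivOfSurjective
        (ZMod.ringHom_surjective (_root_.PadicInt.toZModPow a.valuation))).toEquiv, Nat.card_zmod]
  rw [hcard, _root_.PadicInt.norm_eq_zpow_neg_valuation ha, zpow_neg, inv_inv, zpow_natCast]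
  push_cast
  rfl

/-- Norms of associated elements of `ℤ_p` agree (units have norm `1`). [cite: Washington1997, §13.2] -/
theorem norm_eq_of_associated {a b : ℤ_[p]} (h : Associated a b) : ‖a‖ = ‖b‖ := by
  obtain ⟨u, rfl⟩ := h
  rw [norm_mul, _root_.PadicInt.isUnit_iff.mp u.isUnit, mul_one]

/-- The norm of a finite product in `ℤ_p` is the product of the norms. [cite: Washington1997, §13.2] -/
theorem norm_prod {ι : Type*} (s : Finset ι) (f : ι → ℤ_[p]) : ‖∏ i ∈ s, f i‖ = ∏ i ∈ s, ‖f i‖ := by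
  induction s using Finset.induction_on with
  | empty => simp
  | insert i s hi ih => rw [Finset.prod_insert hi, Finset.prod_insert hi, norm_mul, ih]

/-- **`#(M ⧸ N) · ‖det(N ↪ M ∘ e)‖ = 1`** for a finite free `ℤ_p`-module `M`, a submodule `N` and a linear
equivalence `e : M ≃ N` (Smith normal form: in adapted bases the inclusion is `diag(a₁, …, a_d)`,
`M ⧸ N ≅ ⊕ ℤ_p/(aᵢ)`, `det = u · ∏ aᵢ`). The `ℤ_p`-analogue of Mathlib's `Submodule.natAbs_det_equiv`.
[cite: Washington1997, §13.3 (proof of Thm. 13.13)] -/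
theorem card_quotient_mul_norm_det_eq_one {M : Type*} [AddCommGroup M] [Module ℤ_[p] M]
    [Module.Free ℤ_[p] M] [Module.Finite ℤ_[p] M] (N : Submodule ℤ_[p] M) (e : M ≃ₗ[ℤ_[p]] N) :
    (Nat.card (M ⧸ N) : ℝ) * ‖LinearMap.det (N.subtype ∘ₗ (e : M →ₗ[ℤ_[p]] N))‖ = 1 := by
  let b := Module.Free.chooseBasis ℤ_[p] M
  have h : Module.finrank ℤ_[p] N = Module.finrank ℤ_[p] M := e.symm.finrank_eq
  let a := Submodule.smithNormalFormCoeffs b h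
  let b' := Submodule.smithNormalFormTopBasis b h
  let ab := Submodule.smithNormalFormBotBasis b h
  have ab_eq := Submodule.smithNormalFormBotBasis_def b h
  let e' : M ≃ₗ[ℤ_[p]] N := b'.equiv ab (Equiv.refl _)
  let f : M →ₗ[ℤ_[p]] M := N.subtype ∘ₗ (e' : M →ₗ[ℤ_[p]] N)
  have f_apply : ∀ x, f x = b'.equiv ab (Equiv.refl _) x := fun x => rfl
  have ha : ∀ i, f (b' i) = a i • b' i := by
    intro i
    rw [f_apply, b'.equiv_apply, Equiv.refl_apply]
    exact ab_eq i
  -- `det f = ∏ aᵢ`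
  have hdetf : LinearMap.det f = ∏ i, a i := by
    rw [← LinearMap.det_toMatrix b']
    have hM : LinearMap.toMatrix b' b' f = Matrix.diagonal a := by
      ext i j
      rw [LinearMap.toMatrix_apply, ha, map_smul, Basis.repr_self, Finsupp.smul_single,
        smul_eq_mul, mul_one]
      by_cases hij : i = j
      · rw [hij, Matrix.diagonal_apply_eq, Finsupp.single_eq_same]
      · rw [Matrix.diagonal_apply_ne _ hij, Finsupp.single_eq_of_ne hij]
    rw [hM, Matrix.det_diagonal]
  -- the determinant for `e` is an associate of the one for `e'`
  have hnorm_eq : ‖LinearMap.det (N.subtype ∘ₗ (e : M →ₗ[ℤ_[p]] N))‖ = ‖LinearMap.det f‖ :=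
    norm_eq_of_associated (LinearMap.associated_det_comp_equiv _ _ _)
  -- `#(M ⧸ N) = ∏ #(ℤ_p ⧸ (aᵢ))`
  have hcard : Nat.card (M ⧸ N) = ∏ i, Nat.card (ℤ_[p] ⧸ Ideal.span {a i}) := by
    rw [Nat.card_congr (Submodule.quotientEquivPiSpan N b h).toEquiv, Nat.card_pi]
  rw [hnorm_eq, hdetf, hcard, Nat.cast_prod, norm_prod, ← Finset.prod_mul_distrib]
  refine Finset.prod_eq_one fun i _ => ?_
  rw [card_quotient_span_singleton (Submodule.smithNormalFormCoeffs_ne_zero b h i), inv_mul_cancel₀]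
  exact norm_ne_zero_iff.mpr (Submodule.smithNormalFormCoeffs_ne_zero b h i)

/-- **`#(M ⧸ φ(M)) = ‖det φ‖⁻¹`** for an injective endomorphism `φ` of a finite free `ℤ_p`-module.
[cite: Washington1997, §13.3 (proof of Thm. 13.13)] -/
theorem card_quotient_range_eq_inv_norm_det {M : Type*} [AddCommGroup M] [Module ℤ_[p] M]
    [Module.Free ℤ_[p] M] [Module.Finite ℤ_[p] M] (φ : M →ₗ[ℤ_[p]] M) (hφ : Function.Injective φ) :
    (Nat.card (M ⧸ LinearMap.range φ) : ℝ) = ‖LinearMap.det φ‖⁻¹ := by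
  let e : M ≃ₗ[ℤ_[p]] LinearMap.range φ := LinearEquiv.ofInjective φ hφ
  have h := card_quotient_mul_norm_det_eq_one (LinearMap.range φ) e
  have hφe : (LinearMap.range φ).subtype ∘ₗ (e : M →ₗ[ℤ_[p]] LinearMap.range φ) = φ := by
    ext x; rfl
  rw [hφe] at h
  exact eq_inv_of_mul_eq_one_left h

/-- **`#(S ⧸ (s)) = ‖N_{S/ℤ_p}(s)‖⁻¹`** for a non-zero-divisor `s` of a commutative `ℤ_p`-algebra `S` which is finite
free as a `ℤ_p`-module (`N_{S/ℤ_p}(s) = det` of multiplication by `s`). [cite: Washington1997, §13.3 (proof of Thm. 13.13)] -/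
theorem card_quotient_span_singleton_eq_inv_norm_norm {S : Type*} [CommRing S] [Algebra ℤ_[p] S]
    [Module.Free ℤ_[p] S] [Module.Finite ℤ_[p] S] {s : S} (hs : ∀ x : S, s * x = 0 → x = 0) :
    (Nat.card (S ⧸ Ideal.span {s}) : ℝ) = ‖Algebra.norm ℤ_[p] s‖⁻¹ := by
  have hinj : Function.Injective (Algebra.lmul ℤ_[p] S s) := by
    intro x y hxy
    have h1 : s * (x - y) = 0 := by
      rw [mul_sub]
      exact sub_eq_zero.mpr hxy
    exact sub_eq_zero.mp (hs _ h1)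
  rw [Algebra.norm_apply, ← card_quotient_range_eq_inv_norm_det _ hinj]
  have hrange : LinearMap.range (Algebra.lmul ℤ_[p] S s) = (Ideal.span {s}).restrictScalars ℤ_[p] := by
    ext x
    rw [LinearMap.mem_range, Submodule.restrictScalars_mem, Ideal.mem_span_singleton']
    constructor
    · rintro ⟨y, rfl⟩; exact ⟨y, mul_comm y s⟩
    · rintro ⟨y, rfl⟩; exact ⟨y, mul_comm s y⟩
  congr 1
  rw [Nat.card_congr (Submodule.quotEquivOfEq _ _ hrange).toEquiv]
  exact (Nat.card_congr (Submodule.Quotient.restrictScalarsEquiv ℤ_[p] (Ideal.span {s})).toEquiv).symm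

end PadicInt

end Literature.NumberTheory.EllipticCurves

end
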